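import Mathlib.Analysis.Calculus.ContDiff.Operations
import Literature.NumberTheory.Sieve.MaynardSmallK
import HarnessLib

/-!
# Maynard's Proposition 4.3 (2): `M₁₀₅ > 4` (explicit test function and exact-arithmetic certificate, §7)

Topic `Literature/NumberTheory/Sieve`; companion ("Proofs") file of `MaynardTao.lean`, discharging
its named fact `Literature.NumberTheory.Sieve.exists_four_lt_maynardFunctional` sorry-free:

* `Literature.exists_four_lt_maynardFunctional_holds : Literature.exists_four_lt_maynardFunctional` —
  **Maynard 2015, Prop. 4.3 (2)**: there is an admissible `F` on `R₁₀₅` with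
  `(∑ₘ J₁₀₅^{(m)}(F)) / I₁₀₅(F) > 4` (J. Maynard, *Small gaps between primes*, Ann. of Math. (2)
  181 (2015), 383–413 = arXiv:1311.4600, Prop. 4.3, p. 7, proved in §7, pp. 15–16 of the arXiv
  text).

This is the input "`M₁₀₅ > 4`" of the proofs of Theorems 1.3/1.4 (`liminf (p_{n+1} − p_n) ≤ 600`,
and `≤ 600` for `p_{n+2} − p_n` under EH) in §4 of the paper; see `ParityWave0MaynardProofs.lean`
and `MaynardBoundedGaps.lean` for those deductions. The companion fact Prop. 4.3 (1) (`M₅ > 2`) is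
discharged in `MaynardSmallK.lean` (`Literature.NumberTheory.Sieve.exists_two_lt_maynardFunctional_five_holds`, exact value
`1417255/708216`), on which this file builds (`maynardI_indicator_eq`, `maynardJ_indicator_eq`,
`isMaynardAdmissible_indicator`, the Beta integral of `MaynardSimplexIntegrals.lean`).

## The printed argument (Maynard 2015 §7) and what is formalised

Maynard takes `F = P · 1_{R_k}` (the display after the Remark opening §7, p. 15) with
`P = ∑ᵢ aᵢ (1 − P₁)^{bᵢ} P₂^{cᵢ}` a polynomial in the power sums `P₁ = ∑ tₗ`, `P₂ = ∑ tₗ²`,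
computes `I_k(F)` and `J_k^{(m)}(F)` as rational quadratic forms in `a` (Lemma 7.1:
`∫_{R_k} (1 − P₁)^a P_j^b = a! G_{b,j}(k)/(k + jb + a)!`; Lemma 7.2: the two quadratic forms), and
for `k = 105` reports that with all `42` monomials `b + 2c ≤ 11` the largest eigenvalue of
`M₁⁻¹M₂` is `4.0020697… > 4`, adding: "by taking a rational approximation to the corresponding
eigenvector, we can verify this lower bound by calculating the ratio `∑ₘ J_k(F)/I_k(F)` using only
exact arithmetic" (p. 16). That exact-arithmetic verification is what this file carries out inside
Lean's kernel. Unlike the case `k = 5` (`MaynardSmallK.lean`, monomials with `c ≤ 2`, for which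
the three moments `G_{0,2}, G_{1,2}, G_{2,2}` suffice), `k = 105` needs `P₂`-degree up to `5` in
`P` (so up to `10` in `P²`), hence Lemma 7.1 for all `c`:

1. `integral_sub_pow_mul_pow` — the scaled beta integral `∫₀ᴸ (L − u)ᵃ uᵇ du`, from
   `MaynardTao.integral_pow_mul_one_sub_pow` (`MaynardSimplexIntegrals.lean`).
2. `setIntegral_maynardSimplex_succ` — slicing `R_{n+1}` along one coordinate
   (`∫_{R_{n+1}} f = ∫_{s ∈ R_n} ∫₀^{1−∑s} f(insertNth m u s) du ds`, the first sentence of the proof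
   of Lemma 7.1), for Bochner integrals, via the volume-preserving `MeasurableEquiv.piFinSuccAbove`.
3. `integral_simplex_moment` — **Lemma 7.1 for `j = 2` and every `c`** in the recursive closed form
   `∫_{R_k} (1 − P₁)^a P₂^c = a! c! S(k, c)/(k + a + 2c)!`, where
   `S(k, c) = ∑_{β₁+⋯+β_k = c} ∏ (2βᵢ)!/βᵢ!` (so `G_{c,2}(k) = c! S(k, c)` in the notation of
   Lemma 7.1) is DEFINED by the recursion `S(k+1, c) = ∑_{j ≤ c} ((2j)!/j!) S(k, c − j)` (`dS`),
   which is exactly what one induction step (integrate out one coordinate, binomial theorem in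
   `u²`) produces; the closed form of `G_{b,j}` by compositions is not needed.
4. `maynardI_maynardF`, `maynardJ_maynardF` — **Lemma 7.2**: `I_k(F)` and `J_k^{(m)}(F)` (for
   every `m`) as the explicit double/quadruple sums `maynardIValue`, `maynardJValue` (the
   `γ`-coefficients of Lemma 7.2 written with `j = cᵢ − c′`), on top of `maynardI_indicator_eq`,
   `maynardJ_indicator_eq` of `MaynardSmallK.lean`.
5. `mirrorI`, `mirrorJ` — the same sums multiplied by `N!` (all denominators divide `N!` once
   `N ≥ k + bᵢ + bⱼ + 2cᵢ + 2cⱼ + 1`), as exact integers computable by the kernel (`sRow`: the rows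
   `S(k, 0..C)` by iterated convolution; `facRatio N x = N!/x!`; `binomK`: binomials as
   `descFactorial/factorial`, avoiding Pascal recursion), with the bridges
   `factorial_mul_maynardIValue`, `factorial_mul_maynardJValue`.
6. `isMaynardAdmissible_and_lt_of_cert` — if `0 < mirrorI` and `r · mirrorI < k · mirrorJ` then
   `F` is admissible and `r < (∑ₘ J_k^{(m)}(F))/I_k(F)`.
7. The certificate, checked by `decide +kernel`: for `k = 105` the `42` monomials `b + 2c ≤ 11`
   (`certB`, `certC`) with integer coefficients `certA` (a 6-significant-digit rational
   approximation of the top generalized eigenvector, common denominator cleared; ratio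
   `= 4.00206…`), `4 · mirrorI < 105 · mirrorJ` (`cert105_lt`). As a consistency check of the
   whole pipeline the kernel also confirms, for Maynard's printed `k = 5` polynomial scaled by `70`
   (`fiveA = (70, 49, 5, −15)` on the monomials `(1−P₁)P₂, (1−P₁)², P₂, (1−P₁)`), that
   `2 · mirrorI < 5 · mirrorJ` (`cert5_lt`; the exact ratio is the printed `1417255/708216` of
   `MaynardTao.maynardFunctional_maynardF5`).

Admissibility is in the square-integrable sense of `IsMaynardAdmissible` (`MaynardTao.lean`,
Polymath 8b §3), which polynomials times `1_{R_k}` satisfy (`MaynardTao.isMaynardAdmissible_indicator`);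
Maynard's `𝒮_k` (piecewise differentiable, p. 15) contains these `F` as well, and `maynardPoly` is
smooth (`contDiff_maynardPoly`), the form consumed by Prop. 4.1.

## References

* J. Maynard, *Small gaps between primes*, Ann. of Math. (2) 181 (2015), 383–413,
  doi:10.4007/annals.2015.181.1.7, arXiv:1311.4600 [MaynardAnnals2015]: Prop. 4.3 (p. 7); §7
  (pp. 15–16 of the arXiv text): the choice `F = P · 1_{R_k}`, Lemma 7.1 and its proof (the beta
  identity, the binomial expansion of `P_j^b`), Lemma 7.2 and its proof, Lemma 7.3, and the proof of
  Prop. 4.3 (i), (ii) (the `42` monomials `b + 2c ≤ 11`, `λ ≈ 4.0020697 > 4`, the remark on exact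
  arithmetic, and the explicit `P` for `k = 5` with ratio `1417255/708216`).
* D. H. J. Polymath, *Variants of the Selberg sieve, and bounded intervals containing many primes*,
  Res. Math. Sci. 1:12 (2014), §3 (the `L²` class of test functions) [Polymath8b2014].
-/


open MeasureTheory Set Filter Finset intervalIntegral
open scoped BigOperators

noncomputable section

namespace Literature.NumberTheory.Sieve.MaynardK105

/-! ### One-variable integrals (the beta function identity of the proof of Lemma 7.1) -/

/-- Scaled beta integral: `∫₀ᴸ (L − u)ᵃ uᵇ du = L^{a+b+1} a! b!/(a + b + 1)!` for every real `L`
(the substitution `v = t₁/(1 − ∑_{i ≥ 2} tᵢ)` of the proof of Lemma 7.1, p. 15), from the Beta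
integral `MaynardTao.integral_pow_mul_one_sub_pow`; an interval-integral form, valid for all `L`, of
`MaynardTao.integral_Icc_sub_pow_mul_pow`. [cite: MaynardAnnals2015, proof of Lemma 7.1] -/
theorem integral_sub_pow_mul_pow (a b : ℕ) (L : ℝ) :
    ∫ u in (0:ℝ)..L, (L - u) ^ a * u ^ b =
      L ^ (a + b + 1) * (((a.factorial * b.factorial : ℕ) : ℝ) / (a + b + 1).factorial) := by
  obtain rfl | hL := eq_or_ne L 0
  · rw [intervalIntegral.integral_same, zero_pow (Nat.succ_ne_zero _), zero_mul]
  have key := intervalIntegral.integral_comp_mul_left (fun u => (L - u) ^ a * u ^ b) (c := L) hL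
    (a := 0) (b := 1)
  rw [mul_zero, mul_one] at key
  have hbeta : ((a.factorial * b.factorial : ℕ) : ℝ) / (a + b + 1).factorial =
      ∫ v in (0:ℝ)..1, v ^ b * (1 - v) ^ a := by
    rw [MaynardTao.integral_pow_mul_one_sub_pow b a, show b + a + 1 = a + b + 1 by ring]
    push_cast
    ring
  rw [hbeta]
  have h2 : ∫ v in (0:ℝ)..1, (L - L * v) ^ a * (L * v) ^ b =
      L ^ (a + b) * ∫ v in (0:ℝ)..1, v ^ b * (1 - v) ^ a := by
    rw [← intervalIntegral.integral_const_mul]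
    refine intervalIntegral.integral_congr fun v _ => ?_
    rw [show L - L * v = L * (1 - v) by ring, mul_pow, mul_pow, pow_add]
    ring
  rw [h2, smul_eq_mul] at key
  have h3 : ∫ u in (0:ℝ)..L, (L - u) ^ a * u ^ b =
      L * (L ^ (a + b) * ∫ v in (0:ℝ)..1, v ^ b * (1 - v) ^ a) := by
    rw [key, mul_inv_cancel_left₀ hL]
  rw [h3, pow_succ]
  ring

/-! ### Slicing the simplex and the cube along one coordinate -/

/-- **Slicing the simplex.** For `f` integrable on `R_{n+1}` and any coordinate `m`,
`∫_{R_{n+1}} f = ∫_{s ∈ R_n} ∫₀^{1 − ∑ s} f(insertNth m u s) du ds` (Fubini through the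
volume-preserving `MeasurableEquiv.piFinSuccAbove`; the first step of the proof of Maynard 2015,
Lemma 7.1). [folklore] -/
theorem setIntegral_maynardSimplex_succ {n : ℕ} (m : Fin (n + 1)) (f : (Fin (n + 1) → ℝ) → ℝ)
    (hf : IntegrableOn f (maynardSimplex (n + 1))) :
    ∫ t in maynardSimplex (n + 1), f t =
      ∫ s in maynardSimplex n, ∫ u in (0:ℝ)..(1 - ∑ i, s i), f (Fin.insertNth m u s) := by
  set e := MeasurableEquiv.piFinSuccAbove (fun _ : Fin (n + 1) => ℝ) m with he_def
  have he : MeasurePreserving e.symm (volume.prod volume) volume := by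
    have := (volume_preserving_piFinSuccAbove (fun _ : Fin (n + 1) => ℝ) m).symm
    rwa [Measure.volume_eq_prod] at this
  have he_apply : ∀ p : ℝ × (Fin n → ℝ), e.symm p = Fin.insertNth m p.1 p.2 := fun p => by
    rw [he_def, MeasurableEquiv.piFinSuccAbove_symm_apply]; rfl
  -- the preimage of the simplex
  set T : Set (ℝ × (Fin n → ℝ)) :=
    {p | (∀ i, 0 ≤ p.2 i) ∧ 0 ≤ p.1 ∧ p.1 + ∑ i, p.2 i ≤ 1} with hT_def
  have hpre : e.symm ⁻¹' maynardSimplex (n + 1) = T := by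
    ext ⟨u, s⟩
    rw [Set.mem_preimage, he_apply, MaynardTao.insertNth_mem_maynardSimplex_iff]
    rfl
  have hTm : MeasurableSet T := by
    rw [← hpre]
    exact e.symm.measurable (measurableSet_maynardSimplex (n + 1))
  -- transport the integral and integrability
  rw [← he.setIntegral_preimage_emb e.symm.measurableEmbedding f (maynardSimplex (n + 1)), hpre]
  have hint : IntegrableOn (fun p => f (e.symm p)) T (volume.prod volume) := by
    have := (he.integrableOn_comp_preimage e.symm.measurableEmbedding (f := f)
      (s := maynardSimplex (n + 1))).2 hf
    rwa [hpre] at this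
  rw [← MeasureTheory.integral_indicator hTm,
    integral_prod_symm _ ((integrable_indicator_iff hTm).2 hint)]
  -- compute the inner integrals fibrewise
  rw [← MeasureTheory.integral_indicator (measurableSet_maynardSimplex n)]
  refine integral_congr_ae (ae_of_all _ fun s => ?_)
  simp only
  by_cases hs : s ∈ maynardSimplex n
  · rw [Set.indicator_of_mem hs]
    have hL : 0 ≤ 1 - ∑ i, s i := by have := hs.2; linarith
    have hsec : ∀ u, T.indicator (fun p => f (e.symm p)) (u, s) =
        (Set.Icc 0 (1 - ∑ i, s i)).indicator (fun u => f (Fin.insertNth m u s)) u := by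
      intro u
      by_cases hu : u ∈ Set.Icc 0 (1 - ∑ i, s i)
      · rw [Set.indicator_of_mem hu, Set.indicator_of_mem, he_apply]
        exact ⟨hs.1, hu.1, by linarith [hu.2]⟩
      · rw [Set.indicator_of_notMem hu, Set.indicator_of_notMem]
        rintro ⟨-, h1, h3⟩
        exact hu ⟨h1, by linarith⟩
    simp_rw [hsec]
    rw [MeasureTheory.integral_indicator measurableSet_Icc, integral_Icc_eq_integral_Ioc,
      intervalIntegral.integral_of_le hL]
  · rw [Set.indicator_of_notMem hs]
    have hsec : ∀ u, T.indicator (fun p => f (e.symm p)) (u, s) = 0 := by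
      intro u
      apply Set.indicator_of_notMem
      rintro ⟨h2, h1, h3⟩
      apply hs
      refine ⟨h2, ?_⟩
      simpa using (show ∑ i, s i ≤ 1 by linarith)
    simp_rw [hsec]
    exact integral_zero _ _

/-! ### The numbers `S(k, c)` and the moments `∫_{R_k} (1 − P₁)^a P₂^c` (Lemma 7.1, `j = 2`) -/

/-- `S(k, c) = ∑_{β₁ + ⋯ + β_k = c} ∏ᵢ (2βᵢ)!/βᵢ!`, the inner sum of Maynard's Lemma 7.1 for
`j = 2` (so that `G_{c,2}(k) = c! · S(k, c)`), DEFINED by peeling off one coordinate: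
`S(0, 0) = 1`, `S(0, c+1) = 0`, `S(k+1, c) = ∑_{j ≤ c} ((2j)!/j!) · S(k, c − j)`
(`(2j)!/j! = Nat.descFactorial (2j) j`). [cite: MaynardAnnals2015, Lemma 7.1] -/
def dS : ℕ → ℕ → ℕ
  | 0, 0 => 1
  | 0, _ + 1 => 0
  | k + 1, c => ∑ j ∈ Finset.range (c + 1), (2 * j).descFactorial j * dS k (c - j)

/-- `S(0, 0) = 1` (empty product). [cite: MaynardAnnals2015, Lemma 7.1] -/
@[simp] theorem dS_zero_zero : dS 0 0 = 1 := by simp [dS]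

/-- `S(0, c + 1) = 0` (no compositions of a positive number into zero parts).
[cite: MaynardAnnals2015, Lemma 7.1] -/
@[simp] theorem dS_zero_succ (c : ℕ) : dS 0 (c + 1) = 0 := by simp [dS]

/-- The recursion `S(k+1, c) = ∑_{j ≤ c} ((2j)!/j!) S(k, c − j)`. [cite: MaynardAnnals2015, Lemma 7.1] -/
theorem dS_succ (k c : ℕ) :
    dS (k + 1) c = ∑ j ∈ Finset.range (c + 1), (2 * j).descFactorial j * dS k (c - j) := by
  rw [dS]

/-- The factorial bookkeeping of the induction step of Lemma 7.1:
`C(c, j) (2j)! (c − j)! = c! · (2j)!/j!`. [folklore] -/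
theorem choose_mul_factorial_two_mul (c j : ℕ) (hj : j ≤ c) :
    c.choose j * (2 * j).factorial * (c - j).factorial = c.factorial * (2 * j).descFactorial j := by
  have h1 := Nat.choose_mul_factorial_mul_factorial hj
  have h2 : (2 * j - j).factorial * (2 * j).descFactorial j = (2 * j).factorial :=
    Nat.factorial_mul_descFactorial (by omega)
  rw [show 2 * j - j = j by omega] at h2
  calc c.choose j * (2 * j).factorial * (c - j).factorial
      = c.choose j * (j.factorial * (2 * j).descFactorial j) * (c - j).factorial := by rw [h2]
    _ = (c.choose j * j.factorial * (c - j).factorial) * (2 * j).descFactorial j := by ring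
    _ = c.factorial * (2 * j).descFactorial j := by rw [h1]

/-- The one-variable integration of the proofs of Lemmas 7.1/7.2 (binomial theorem in `u²`, then
the beta integral): for all real `L`, `P`,
`∫₀ᴸ (L − u)ᵃ (u² + P)ᶜ du = ∑_{j ≤ c} C(c, j) P^{c−j} · a! (2j)!/(a + 2j + 1)! · L^{a+2j+1}`
(Maynard 2015, proof of Lemma 7.2, the display computing `∫₀^{1−∑} (1 − P₁)ᵇ P₂ᶜ dt₁`, with
`j = c − c′`). [cite: MaynardAnnals2015, proof of Lemma 7.2] -/
theorem integral_sub_pow_mul_sq_add_pow (a c : ℕ) (L P : ℝ) :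
    ∫ u in (0:ℝ)..L, (L - u) ^ a * (u ^ 2 + P) ^ c =
      ∑ j ∈ Finset.range (c + 1), (c.choose j : ℝ) * P ^ (c - j) *
        ((((a.factorial * (2 * j).factorial : ℕ) : ℝ) / (a + 2 * j + 1).factorial) *
          L ^ (a + 2 * j + 1)) := by
  have hrw : ∀ u : ℝ, (L - u) ^ a * (u ^ 2 + P) ^ c =
      ∑ j ∈ Finset.range (c + 1), (c.choose j : ℝ) * P ^ (c - j) * ((L - u) ^ a * u ^ (2 * j)) := by
    intro u
    rw [add_pow, Finset.mul_sum]
    refine Finset.sum_congr rfl fun j _ => ?_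
    rw [← pow_mul]
    ring
  simp_rw [hrw]
  rw [intervalIntegral.integral_finsetSum fun j _ => ?_]
  · refine Finset.sum_congr rfl fun j _ => ?_
    rw [intervalIntegral.integral_const_mul, integral_sub_pow_mul_pow]
    ring
  · exact (Continuous.intervalIntegrable (by fun_prop) _ _)

/-- **Maynard 2015, Lemma 7.1 with `j = 2`, in closed recursive form**:
`∫_{R_k} (1 − P₁)ᵃ P₂ᶜ dt = a! c! S(k, c)/(k + a + 2c)!` (the printed statement reads
`a! G_{c,2}(k)/(k + 2c + a)!` with `G_{c,2}(k) = c! ∑_{β₁+⋯+β_k = c} ∏ (2βᵢ)!/βᵢ! = c! S(k, c)`).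
Proof by induction on `k` as in the paper: slice off one coordinate
(`setIntegral_maynardSimplex_succ`), expand `(u² + P₂′)ᶜ` binomially and integrate in `u` by the
beta identity (`integral_sub_pow_mul_sq_add_pow`), and collect with
`C(c, j)(2j)!(c − j)! = c!(2j)!/j!`. [cite: MaynardAnnals2015, Lemma 7.1] -/
theorem integral_simplex_moment (k a c : ℕ) :
    ∫ t in maynardSimplex k, (1 - ∑ i, t i) ^ a * (∑ i, t i ^ 2) ^ c =
      ((a.factorial * c.factorial * dS k c : ℕ) : ℝ) / (k + a + 2 * c).factorial := by
  induction k generalizing a c with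
  | zero =>
    rw [MaynardTao.maynardSimplex_zero, Measure.restrict_univ, Measure.volume_pi_eq_dirac (0 : Fin 0 → ℝ),
      integral_dirac]
    cases c with
    | zero =>
      have h : ((a.factorial : ℕ) : ℝ) ≠ 0 := by exact_mod_cast a.factorial_ne_zero
      simp [h]
    | succ c => simp
  | succ k ih =>
    have hcont : Continuous fun t : Fin (k + 1) → ℝ => (1 - ∑ i, t i) ^ a * (∑ i, t i ^ 2) ^ c := by
      fun_prop
    rw [setIntegral_maynardSimplex_succ 0 _
      (hcont.continuousOn.integrableOn_compact (isCompact_maynardSimplex _))]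
    have hinner : ∀ s : Fin k → ℝ,
        ∫ u in (0:ℝ)..(1 - ∑ i, s i), (1 - ∑ i, Fin.insertNth 0 u s i) ^ a *
            (∑ i, Fin.insertNth 0 u s i ^ 2) ^ c =
          ∑ j ∈ Finset.range (c + 1),
            ((c.choose j : ℝ) * (((a.factorial * (2 * j).factorial : ℕ) : ℝ) /
              (a + 2 * j + 1).factorial)) *
            ((1 - ∑ i, s i) ^ (a + 2 * j + 1) * (∑ i, s i ^ 2) ^ (c - j)) := by
      intro s
      simp_rw [MaynardTao.sum_insertNth_eq, MaynardTao.sum_sq_insertNth_eq]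
      have : ∀ u : ℝ, (1 - (u + ∑ i, s i)) ^ a = ((1 - ∑ i, s i) - u) ^ a := fun u => by ring_nf
      simp_rw [this, integral_sub_pow_mul_sq_add_pow]
      refine Finset.sum_congr rfl fun j _ => ?_
      ring
    simp_rw [hinner]
    have hint : ∀ j ∈ Finset.range (c + 1), Integrable (fun s : Fin k → ℝ =>
        ((c.choose j : ℝ) * (((a.factorial * (2 * j).factorial : ℕ) : ℝ) /
            (a + 2 * j + 1).factorial)) *
          ((1 - ∑ i, s i) ^ (a + 2 * j + 1) * (∑ i, s i ^ 2) ^ (c - j)))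
        (volume.restrict (maynardSimplex k)) := by
      intro j _
      have hc : Continuous fun s : Fin k → ℝ =>
          ((c.choose j : ℝ) * (((a.factorial * (2 * j).factorial : ℕ) : ℝ) /
            (a + 2 * j + 1).factorial)) *
          ((1 - ∑ i, s i) ^ (a + 2 * j + 1) * (∑ i, s i ^ 2) ^ (c - j)) := by fun_prop
      exact hc.continuousOn.integrableOn_compact (isCompact_maynardSimplex _)
    rw [integral_finsetSum _ hint]
    simp_rw [MeasureTheory.integral_const_mul, ih]
    -- the algebra
    have hterm : ∀ j ∈ Finset.range (c + 1),
        (c.choose j : ℝ) * (((a.factorial * (2 * j).factorial : ℕ) : ℝ) / (a + 2 * j + 1).factorial) *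
          ((((a + 2 * j + 1).factorial * (c - j).factorial * dS k (c - j) : ℕ) : ℝ) /
            (k + (a + 2 * j + 1) + 2 * (c - j)).factorial) =
        (((a.factorial * c.factorial : ℕ) : ℝ) / (k + 1 + a + 2 * c).factorial) *
          (((2 * j).descFactorial j * dS k (c - j) : ℕ) : ℝ) := by
      intro j hj
      have hjc : j ≤ c := Nat.lt_succ_iff.mp (Finset.mem_range.mp hj)
      have h1 : k + (a + 2 * j + 1) + 2 * (c - j) = k + 1 + a + 2 * c := by omega
      rw [h1]
      have h2 : ((a + 2 * j + 1).factorial : ℝ) ≠ 0 := by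
        exact_mod_cast (a + 2 * j + 1).factorial_ne_zero
      have h3 : ((k + 1 + a + 2 * c).factorial : ℝ) ≠ 0 := by
        exact_mod_cast (k + 1 + a + 2 * c).factorial_ne_zero
      have h4 := choose_mul_factorial_two_mul c j hjc
      field_simp
      have h5 : (c.choose j : ℝ) * (2 * j).factorial * (c - j).factorial =
          c.factorial * (2 * j).descFactorial j := by exact_mod_cast h4
      push_cast
      linear_combination
        ((a.factorial : ℝ) * ((a + 2 * j + 1).factorial : ℝ) * (dS k (c - j) : ℝ)) * h5
    rw [Finset.sum_congr rfl hterm, ← Finset.mul_sum, dS_succ]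
    push_cast
    ring

/-! ### Maynard's polynomial test functions `F = 1_{R_k} · ∑ᵢ Aᵢ (1 − P₁)^{bᵢ} P₂^{cᵢ}` and `I_k(F)` (Lemma 7.2) -/

section Poly

variable {ι : Type*} [Fintype ι]

/-- The symmetric polynomial `P = ∑ᵢ Aᵢ (1 − P₁)^{bᵢ} P₂^{cᵢ}` in the power sums `P₁ = ∑ tₗ`,
`P₂ = ∑ tₗ²` (Maynard 2015, Lemma 7.2: "`P = ∑_{i=1}^d aᵢ (1 − P₁)^{bᵢ} P₂^{cᵢ}` for constants
`aᵢ ∈ ℝ` and non-negative integers `bᵢ, cᵢ`"). [cite: MaynardAnnals2015, Lemma 7.2] -/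
def maynardPoly (k : ℕ) (A : ι → ℝ) (b c : ι → ℕ) (t : Fin k → ℝ) : ℝ :=
  ∑ i, A i * ((1 - ∑ l, t l) ^ b i * (∑ l, t l ^ 2) ^ c i)

/-- The test function `F = P` on `R_k` and `0` otherwise (Maynard 2015 §7, the display defining
`F` in terms of `P`, p. 15). [cite: MaynardAnnals2015, §7, choice of F (p. 15)] -/
def maynardF (k : ℕ) (A : ι → ℝ) (b c : ι → ℕ) : (Fin k → ℝ) → ℝ :=
  (maynardSimplex k).indicator (maynardPoly k A b c)

/-- `P` is continuous (a polynomial in the coordinates). [folklore] -/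
theorem continuous_maynardPoly (k : ℕ) (A : ι → ℝ) (b c : ι → ℕ) :
    Continuous (maynardPoly k A b c) := by
  unfold maynardPoly
  fun_prop

/-- `P` is smooth (`C^n` for every `n`), being a polynomial in the coordinates; in particular the
test functions `F = P · 1_{R_k}` are restrictions to `R_k` of `C¹` functions, the form in which
Maynard's Prop. 4.1 (piecewise differentiable `F` supported on `R_k`) is consumed. [folklore] -/
theorem contDiff_maynardPoly (k : ℕ) (A : ι → ℝ) (b c : ι → ℕ) {n : WithTop ℕ∞} :
    ContDiff ℝ n (maynardPoly k A b c) := by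
  unfold maynardPoly
  fun_prop

/-- `P² = ∑ᵢ ∑ⱼ Aᵢ Aⱼ (1 − P₁)^{bᵢ+bⱼ} P₂^{cᵢ+cⱼ}` (Maynard 2015, proof of Lemma 7.2, first
display). [cite: MaynardAnnals2015, proof of Lemma 7.2] -/
theorem maynardPoly_sq (k : ℕ) (A : ι → ℝ) (b c : ι → ℕ) (t : Fin k → ℝ) :
    maynardPoly k A b c t ^ 2 =
      ∑ i, ∑ j, A i * A j *
        ((1 - ∑ l, t l) ^ (b i + b j) * (∑ l, t l ^ 2) ^ (c i + c j)) := by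
  rw [sq, maynardPoly, Fintype.sum_mul_sum]
  refine Finset.sum_congr rfl fun i _ => Finset.sum_congr rfl fun j _ => ?_
  rw [pow_add, pow_add]
  ring

/-- The value of `I_k(F)` as a quadratic form in `A` (Maynard 2015, Lemma 7.2, first formula:
`I_k(F) = ∑_{i,j} aᵢ aⱼ (bᵢ + bⱼ)! G_{cᵢ+cⱼ,2}(k)/(k + bᵢ + bⱼ + 2cᵢ + 2cⱼ)!`, with
`G_{c,2}(k) = c! S(k, c)`). [cite: MaynardAnnals2015, Lemma 7.2] -/
def maynardIValue (k : ℕ) (A : ι → ℝ) (b c : ι → ℕ) : ℝ :=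
  ∑ i, ∑ j, A i * A j *
    ((((b i + b j).factorial * (c i + c j).factorial * dS k (c i + c j) : ℕ) : ℝ) /
      (k + (b i + b j) + 2 * (c i + c j)).factorial)

/-- **Maynard 2015, Lemma 7.2, formula for `I_k(F)`**: `I_k(F) = maynardIValue k A b c`
(`I_k(F) = ∫_{R_k} P²`, `MaynardTao.maynardI_indicator_eq`; expand `P²` and apply Lemma 7.1
termwise). [cite: MaynardAnnals2015, Lemma 7.2] -/
theorem maynardI_maynardF (k : ℕ) (A : ι → ℝ) (b c : ι → ℕ) :
    maynardI k (maynardF k A b c) = maynardIValue k A b c := by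
  rw [maynardF, MaynardTao.maynardI_indicator_eq]
  simp_rw [maynardPoly_sq]
  have hint : ∀ i j, Integrable (fun t : Fin k → ℝ => A i * A j *
      ((1 - ∑ l, t l) ^ (b i + b j) * (∑ l, t l ^ 2) ^ (c i + c j)))
      (volume.restrict (maynardSimplex k)) := fun i j => by
    have hc : Continuous (fun t : Fin k → ℝ => A i * A j *
      ((1 - ∑ l, t l) ^ (b i + b j) * (∑ l, t l ^ 2) ^ (c i + c j))) := by fun_prop
    exact hc.continuousOn.integrableOn_compact (isCompact_maynardSimplex k)
  rw [integral_finsetSum _ fun i _ => integrable_finsetSum _ fun j _ => hint i j]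
  refine Finset.sum_congr rfl fun i _ => ?_
  rw [integral_finsetSum _ fun j _ => hint i j]
  refine Finset.sum_congr rfl fun j _ => ?_
  rw [MeasureTheory.integral_const_mul, integral_simplex_moment]

end Poly

/-! ### `J_k^{(m)}(F)` for the polynomial test functions (Lemma 7.2, second formula) -/

section PolyJ

variable {ι : Type*} [Fintype ι]

/-- The polynomial `Q(s) = ∫₀^{1−∑s} P(…, u, …) du` in the remaining `n = k − 1` variables:
`Q = ∑ᵢ ∑_{j ≤ cᵢ} Aᵢ C(cᵢ, j) bᵢ!(2j)!/(bᵢ + 2j + 1)! · (1 − P₁′)^{bᵢ+2j+1} (P₂′)^{cᵢ−j}`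
(Maynard 2015, proof of Lemma 7.2, the display for `∫₀^{1−∑} (1 − P₁)ᵇ P₂ᶜ dt₁`, with
`j = c − c′`). [cite: MaynardAnnals2015, proof of Lemma 7.2] -/
def maynardQ (n : ℕ) (A : ι → ℝ) (b c : ι → ℕ) (s : Fin n → ℝ) : ℝ :=
  ∑ i, ∑ j ∈ Finset.range (c i + 1),
    (A i * ((c i).choose j : ℝ) *
      ((((b i).factorial * (2 * j).factorial : ℕ) : ℝ) / (b i + 2 * j + 1).factorial)) *
    ((1 - ∑ l, s l) ^ (b i + 2 * j + 1) * (∑ l, s l ^ 2) ^ (c i - j))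

/-- `∫₀^{1−∑s} P(insertNth m u s) du = Q(s)` (Maynard 2015, proof of Lemma 7.2).
[cite: MaynardAnnals2015, proof of Lemma 7.2] -/
theorem intervalIntegral_maynardPoly_insertNth {n : ℕ} (m : Fin (n + 1)) (A : ι → ℝ)
    (b c : ι → ℕ) (s : Fin n → ℝ) :
    ∫ u in (0:ℝ)..(1 - ∑ i, s i), maynardPoly (n + 1) A b c (Fin.insertNth m u s) =
      maynardQ n A b c s := by
  unfold maynardPoly maynardQ
  simp_rw [MaynardTao.sum_insertNth_eq, MaynardTao.sum_sq_insertNth_eq]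
  have h1 : ∀ u : ℝ, ∀ i : ι, (1 - (u + ∑ l, s l)) ^ b i = ((1 - ∑ l, s l) - u) ^ b i :=
    fun u i => by ring_nf
  simp_rw [h1]
  rw [intervalIntegral.integral_finsetSum fun i _ => ?_]
  · refine Finset.sum_congr rfl fun i _ => ?_
    rw [intervalIntegral.integral_const_mul, integral_sub_pow_mul_sq_add_pow, Finset.mul_sum]
    refine Finset.sum_congr rfl fun j _ => ?_
    ring
  · exact (Continuous.intervalIntegrable (by fun_prop) _ _)

/-- `Q²` expanded into a quadruple sum of moment integrands (Maynard 2015, proof of Lemma 7.2,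
the display for `(∫₀¹ F dt₁)²`). [cite: MaynardAnnals2015, proof of Lemma 7.2] -/
theorem maynardQ_sq (n : ℕ) (A : ι → ℝ) (b c : ι → ℕ) (s : Fin n → ℝ) :
    maynardQ n A b c s ^ 2 =
      ∑ i, ∑ i', ∑ j ∈ Finset.range (c i + 1), ∑ j' ∈ Finset.range (c i' + 1),
        ((A i * ((c i).choose j : ℝ) *
          ((((b i).factorial * (2 * j).factorial : ℕ) : ℝ) / (b i + 2 * j + 1).factorial)) *
         (A i' * ((c i').choose j' : ℝ) *
          ((((b i').factorial * (2 * j').factorial : ℕ) : ℝ) / (b i' + 2 * j' + 1).factorial))) *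
        ((1 - ∑ l, s l) ^ ((b i + 2 * j + 1) + (b i' + 2 * j' + 1)) *
          (∑ l, s l ^ 2) ^ ((c i - j) + (c i' - j'))) := by
  rw [sq, maynardQ, Fintype.sum_mul_sum]
  refine Finset.sum_congr rfl fun i _ => Finset.sum_congr rfl fun i' _ => ?_
  rw [Finset.sum_mul_sum]
  refine Finset.sum_congr rfl fun j _ => Finset.sum_congr rfl fun j' _ => ?_
  rw [pow_add, pow_add]
  ring

/-- The value of `J_k^{(m)}(F)`, `k = n + 1`, as a quadratic form in `A` (Maynard 2015,
Lemma 7.2, second formula, written with `j = cᵢ − c₁′`, `j′ = cⱼ − c₂′` and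
`G_{c,2}(k − 1) = c! S(k − 1, c)`):
`∑_{i,i′} ∑_{j ≤ cᵢ} ∑_{j′ ≤ c_{i′}} Aᵢ A_{i′} C(cᵢ,j) C(c_{i′},j′) ·
bᵢ!(2j)!/(bᵢ+2j+1)! · b_{i′}!(2j′)!/(b_{i′}+2j′+1)! · (e₁+e₂)! C′! S(n, C′)/(n + e₁ + e₂ + 2C′)!`
with `e₁ = bᵢ + 2j + 1`, `e₂ = b_{i′} + 2j′ + 1`, `C′ = (cᵢ − j) + (c_{i′} − j′)`.
[cite: MaynardAnnals2015, Lemma 7.2] -/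
def maynardJValue (n : ℕ) (A : ι → ℝ) (b c : ι → ℕ) : ℝ :=
  ∑ i, ∑ i', ∑ j ∈ Finset.range (c i + 1), ∑ j' ∈ Finset.range (c i' + 1),
    ((A i * ((c i).choose j : ℝ) *
      ((((b i).factorial * (2 * j).factorial : ℕ) : ℝ) / (b i + 2 * j + 1).factorial)) *
     (A i' * ((c i').choose j' : ℝ) *
      ((((b i').factorial * (2 * j').factorial : ℕ) : ℝ) / (b i' + 2 * j' + 1).factorial))) *
    (((((b i + 2 * j + 1) + (b i' + 2 * j' + 1)).factorial *
        ((c i - j) + (c i' - j')).factorial * dS n ((c i - j) + (c i' - j')) : ℕ) : ℝ) /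
      (n + ((b i + 2 * j + 1) + (b i' + 2 * j' + 1)) + 2 * ((c i - j) + (c i' - j'))).factorial)

/-- **Maynard 2015, Lemma 7.2, formula for `J_k^{(m)}(F)`, for every `m`** (`k = n + 1`):
`J_k^{(m)}(F) = maynardJValue n A b c`. As in the paper: by `MaynardTao.maynardJ_indicator_eq`,
`J_k^{(m)}(F) = ∫_{R_n} (∫₀^{1−∑s} P du)² ds = ∫_{R_n} Q²`; expand `Q²` and apply Lemma 7.1 on
`R_{k−1}` ("Since `F` is symmetric … `J_k^{(m)}(F)` is independent of `m`": here simply because the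
computation is the same for every `m`). [cite: MaynardAnnals2015, Lemma 7.2] -/
theorem maynardJ_maynardF (n : ℕ) (m : Fin (n + 1)) (A : ι → ℝ) (b c : ι → ℕ) :
    maynardJ (n + 1) m (maynardF (n + 1) A b c) = maynardJValue n A b c := by
  rw [maynardF, MaynardTao.maynardJ_indicator_eq]
  simp_rw [intervalIntegral_maynardPoly_insertNth, maynardQ_sq]
  have hint : ∀ i i' j j', Integrable (fun s : Fin n → ℝ =>
      ((A i * ((c i).choose j : ℝ) *
          ((((b i).factorial * (2 * j).factorial : ℕ) : ℝ) / (b i + 2 * j + 1).factorial)) *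
         (A i' * ((c i').choose j' : ℝ) *
          ((((b i').factorial * (2 * j').factorial : ℕ) : ℝ) / (b i' + 2 * j' + 1).factorial))) *
        ((1 - ∑ l, s l) ^ ((b i + 2 * j + 1) + (b i' + 2 * j' + 1)) *
          (∑ l, s l ^ 2) ^ ((c i - j) + (c i' - j'))))
      (volume.restrict (maynardSimplex n)) := fun i i' j j' => by
    refine (Continuous.continuousOn ?_).integrableOn_compact (isCompact_maynardSimplex n)
    fun_prop
  rw [integral_finsetSum _ fun i _ => integrable_finsetSum _ fun i' _ =>
    integrable_finsetSum _ fun j _ => integrable_finsetSum _ fun j' _ => hint i i' j j']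
  refine Finset.sum_congr rfl fun i _ => ?_
  rw [integral_finsetSum _ fun i' _ =>
    integrable_finsetSum _ fun j _ => integrable_finsetSum _ fun j' _ => hint i i' j j']
  refine Finset.sum_congr rfl fun i' _ => ?_
  rw [integral_finsetSum _ fun j _ => integrable_finsetSum _ fun j' _ => hint i i' j j']
  refine Finset.sum_congr rfl fun j _ => ?_
  rw [integral_finsetSum _ fun j' _ => hint i i' j j']
  refine Finset.sum_congr rfl fun j' _ => ?_
  rw [MeasureTheory.integral_const_mul, integral_simplex_moment]

end PolyJ

/-! ### Kernel-computable mirror of the two quadratic forms ("using only exact arithmetic", §7 p. 16) -/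

section Table

/-- One step `S(k, ·) ↦ S(k+1, ·)` of the recursion for `dS` on the truncated row
`[S(k, 0), …, S(k, C)]` (a list, so that the kernel evaluates each row once). [folklore] -/
def sStep (C : ℕ) (prev : List ℕ) : List ℕ :=
  (List.range (C + 1)).map fun c =>
    ((List.range (c + 1)).map fun j => (2 * j).descFactorial j * prev.getD (c - j) 0).sum

/-- The truncated rows `[S(k, 0), …, S(k, C)]` of `dS`, by iterating `sStep`. [folklore] -/
def sRow (C : ℕ) : ℕ → List ℕ
  | 0 => 1 :: List.replicate C 0
  | k + 1 => sStep C (sRow C k)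

/-- `List.sum` of a mapped `List.range` is the `Finset.range` sum. [folklore] -/
theorem list_sum_map_range (f : ℕ → ℕ) (n : ℕ) :
    ((List.range n).map f).sum = ∑ j ∈ Finset.range n, f j := by
  induction n with
  | zero => simp
  | succ n ih => rw [List.range_succ, List.map_append, List.sum_append, ih,
      Finset.sum_range_succ]; simp

/-- The table is correct: `(sRow C k)[c] = S(k, c)` for `c ≤ C`. [folklore] -/
theorem sRow_getD (C : ℕ) : ∀ k c, c ≤ C → (sRow C k).getD c 0 = dS k c := by
  intro k
  induction k with
  | zero =>
    intro c hc
    cases c with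
    | zero => simp [sRow]
    | succ c =>
      simp only [sRow, dS_zero_succ, List.getD_eq_getElem?_getD, List.getElem?_cons_succ,
        List.getElem?_replicate]
      split_ifs <;> simp
  | succ k ih =>
    intro c hc
    rw [sRow, sStep, List.getD_eq_getElem?_getD, List.getElem?_map,
      List.getElem?_range (by omega), Option.map_some, Option.getD_some, list_sum_map_range,
      dS_succ]
    refine Finset.sum_congr rfl fun j hj => ?_
    rw [ih (c - j) (by omega)]

/-- `N!/n!` for `n ≤ N`, computed as the descending factorial `N (N−1) ⋯ (n+1)`. [folklore] -/
def facRatio (N n : ℕ) : ℕ := N.descFactorial (N - n)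

/-- `n! · (N!/n!) = N!` for `n ≤ N`. [folklore] -/
theorem factorial_mul_facRatio {N n : ℕ} (h : n ≤ N) : n.factorial * facRatio N n = N.factorial := by
  have := Nat.factorial_mul_descFactorial (n := N) (k := N - n) (Nat.sub_le N n)
  rwa [show N - (N - n) = n by omega] at this

/-- Binomial coefficients as `descFactorial / factorial` (kernel-friendly: no Pascal recursion). [folklore] -/
def binomK (n r : ℕ) : ℕ := n.descFactorial r / r.factorial

/-- `binomK n r = C(n, r)`. [folklore] -/
theorem binomK_eq_choose (n r : ℕ) : binomK n r = n.choose r :=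
  (Nat.choose_eq_descFactorial_div_factorial n r).symm

end Table

section Mirror

variable {d : ℕ}

/-- `N! · I_k(F)` as an exact integer, for integer coefficients `A` (the sum `maynardIValue` with
every denominator `x!` replaced by the integer `N!/x!`, and `S(k, ·)` read off the table
`sRow Cmax k`). [cite: MaynardAnnals2015, §7, proof of Prop. 4.3 (i): "using only exact arithmetic"] -/
def mirrorI (k N Cmax : ℕ) (A : Fin d → ℤ) (B C : Fin d → ℕ) : ℤ :=
  ∑ i, ∑ j, A i * A j *
    (((B i + B j).factorial * (C i + C j).factorial * (sRow Cmax k).getD (C i + C j) 0 *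
      facRatio N (k + (B i + B j) + 2 * (C i + C j)) : ℕ) : ℤ)

/-- `N! · J_k^{(m)}(F)` (`k = n + 1`) as an exact integer, for integer coefficients `A` (the sum
`maynardJValue` with denominators cleared: `(e₁+e₂)!/(e₁! e₂!) = binomK (e₁+e₂) e₁` and
`N!/x! = facRatio N x`). [cite: MaynardAnnals2015, §7, proof of Prop. 4.3 (i): "using only exact arithmetic"] -/
def mirrorJ (n N Cmax : ℕ) (A : Fin d → ℤ) (B C : Fin d → ℕ) : ℤ :=
  ∑ i, ∑ i', ∑ j ∈ Finset.range (C i + 1), ∑ j' ∈ Finset.range (C i' + 1),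
    A i * A i' *
    (((C i).choose j * (B i).factorial * (2 * j).factorial *
      ((C i').choose j' * (B i').factorial * (2 * j').factorial) *
      binomK ((B i + 2 * j + 1) + (B i' + 2 * j' + 1)) (B i + 2 * j + 1) *
      ((C i - j) + (C i' - j')).factorial *
      (sRow Cmax n).getD ((C i - j) + (C i' - j')) 0 *
      facRatio N (n + ((B i + 2 * j + 1) + (B i' + 2 * j' + 1)) +
        2 * ((C i - j) + (C i' - j'))) : ℕ) : ℤ)

/-- Per-term bridge for `I`: `N! · (a a′ · B! C! S/x!) = a a′ · (B! C! S · N!/x!)` in `ℝ`,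
for `x ≤ N`. [folklore] -/
theorem bridgeI_term (a a' : ℤ) {B C S x N : ℕ} (hx : x ≤ N) :
    ((N.factorial : ℕ) : ℝ) *
        ((a : ℝ) * a' * (((B.factorial * C.factorial * S : ℕ) : ℝ) / x.factorial)) =
      ((a * a' * ((B.factorial * C.factorial * S * facRatio N x : ℕ) : ℤ) : ℤ) : ℝ) := by
  have hR : ((x.factorial : ℕ) : ℝ) * (facRatio N x : ℕ) = (N.factorial : ℕ) := by
    exact_mod_cast factorial_mul_facRatio hx
  rw [← hR]
  have hx0 : ((x.factorial : ℕ) : ℝ) ≠ 0 := by exact_mod_cast x.factorial_ne_zero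
  push_cast
  field_simp

/-- The identity of real numbers behind `bridgeJ_term` (denominators `X = x!`, `E₁ = e₁!`,
`E₂ = e₂!` cleared against `X · R = N!` and `BK · E₁ · E₂ = (e₁+e₂)!`). [folklore] -/
theorem bridgeJ_aux {a a' ch bf jf ch' bf' jf' E1 E2 EE C S X R NF BK : ℝ}
    (hX : X ≠ 0) (h1 : E1 ≠ 0) (h2 : E2 ≠ 0)
    (hR : X * R = NF) (hB : BK * E1 * E2 = EE) :
    NF * ((a * ch * (bf * jf / E1)) * (a' * ch' * (bf' * jf' / E2)) * (EE * C * S / X)) =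
      a * a' * (ch * bf * jf * (ch' * bf' * jf') * BK * C * S * R) := by
  subst hR hB
  calc X * R * (a * ch * (bf * jf / E1) * (a' * ch' * (bf' * jf' / E2)) *
        (BK * E1 * E2 * C * S / X))
      = (X * X⁻¹) * (E1 * E1⁻¹) * (E2 * E2⁻¹) *
          (a * a' * (ch * bf * jf * (ch' * bf' * jf') * BK * C * S * R)) := by ring
    _ = a * a' * (ch * bf * jf * (ch' * bf' * jf') * BK * C * S * R) := by
      rw [mul_inv_cancel₀ hX, mul_inv_cancel₀ h1, mul_inv_cancel₀ h2, one_mul, one_mul, one_mul]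

/-- Per-term bridge for `J`: clearing the three factorial denominators of a term of
`maynardJValue` against `N!`, for `x ≤ N`. [folklore] -/
theorem bridgeJ_term (a a' : ℤ) {ch bf jf ch' bf' jf' e₁ e₂ C S x N : ℕ} (hx : x ≤ N) :
    ((N.factorial : ℕ) : ℝ) *
        ((((a : ℝ) * (ch : ℝ) * (((bf * jf : ℕ) : ℝ) / e₁.factorial)) *
          ((a' : ℝ) * (ch' : ℝ) * (((bf' * jf' : ℕ) : ℝ) / e₂.factorial))) *
         ((((e₁ + e₂).factorial * C.factorial * S : ℕ) : ℝ) / x.factorial)) =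
      ((a * a' * ((ch * bf * jf * (ch' * bf' * jf') * binomK (e₁ + e₂) e₁ * C.factorial * S *
        facRatio N x : ℕ) : ℤ) : ℤ) : ℝ) := by
  have hR : ((x.factorial : ℕ) : ℝ) * (facRatio N x : ℕ) = (N.factorial : ℕ) := by
    exact_mod_cast factorial_mul_facRatio hx
  have hB : ((binomK (e₁ + e₂) e₁ : ℕ) : ℝ) * (e₁.factorial : ℕ) * (e₂.factorial : ℕ) =
      ((e₁ + e₂).factorial : ℕ) := by
    rw [binomK_eq_choose]
    have := Nat.choose_mul_factorial_mul_factorial (n := e₁ + e₂) (k := e₁) (by omega)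
    rw [Nat.add_sub_cancel_left] at this
    exact_mod_cast this
  have hx0 : ((x.factorial : ℕ) : ℝ) ≠ 0 := by exact_mod_cast x.factorial_ne_zero
  have h10 : ((e₁.factorial : ℕ) : ℝ) ≠ 0 := by exact_mod_cast e₁.factorial_ne_zero
  have h20 : ((e₂.factorial : ℕ) : ℝ) ≠ 0 := by exact_mod_cast e₂.factorial_ne_zero
  have key := bridgeJ_aux (a := (a : ℝ)) (a' := (a' : ℝ)) (ch := (ch : ℝ)) (bf := (bf : ℝ))
    (jf := (jf : ℝ)) (ch' := (ch' : ℝ)) (bf' := (bf' : ℝ)) (jf' := (jf' : ℝ))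
    (C := ((C.factorial : ℕ) : ℝ)) (S := (S : ℝ)) hx0 h10 h20 hR hB
  push_cast
  exact key

/-- **Bridge for `I`**: `N! · I_k(F) = mirrorI k N Cmax A B C` whenever `N` clears all the
denominators (`k + Bᵢ + Bⱼ + 2(Cᵢ + Cⱼ) ≤ N`) and the table is long enough (`Cᵢ + Cⱼ ≤ Cmax`).
[cite: MaynardAnnals2015, Lemma 7.2 and §7, proof of Prop. 4.3 (i)] -/
theorem factorial_mul_maynardIValue (k N Cmax : ℕ) (A : Fin d → ℤ) (B C : Fin d → ℕ)
    (hN : ∀ i j, k + (B i + B j) + 2 * (C i + C j) ≤ N) (hC : ∀ i j, C i + C j ≤ Cmax) :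
    ((N.factorial : ℕ) : ℝ) * maynardIValue k (fun i => (A i : ℝ)) B C =
      (mirrorI k N Cmax A B C : ℝ) := by
  rw [maynardIValue, mirrorI, Finset.mul_sum, Int.cast_sum]
  refine Finset.sum_congr rfl fun i _ => ?_
  rw [Finset.mul_sum, Int.cast_sum]
  refine Finset.sum_congr rfl fun j _ => ?_
  rw [sRow_getD Cmax k _ (hC i j)]
  exact bridgeI_term (A i) (A j) (hN i j)

/-- **Bridge for `J`**: `N! · J_k^{(m)}(F) = mirrorJ n N Cmax A B C` (`k = n + 1`) whenever
`n + Bᵢ + B_{i′} + 2(Cᵢ + C_{i′}) + 2 ≤ N` and `Cᵢ + C_{i′} ≤ Cmax`.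
[cite: MaynardAnnals2015, Lemma 7.2 and §7, proof of Prop. 4.3 (i)] -/
theorem factorial_mul_maynardJValue (n N Cmax : ℕ) (A : Fin d → ℤ) (B C : Fin d → ℕ)
    (hN : ∀ i i', n + (B i + B i') + 2 * (C i + C i') + 2 ≤ N) (hC : ∀ i i', C i + C i' ≤ Cmax) :
    ((N.factorial : ℕ) : ℝ) * maynardJValue n (fun i => (A i : ℝ)) B C =
      (mirrorJ n N Cmax A B C : ℝ) := by
  rw [maynardJValue, mirrorJ, Finset.mul_sum, Int.cast_sum]
  refine Finset.sum_congr rfl fun i _ => ?_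
  rw [Finset.mul_sum, Int.cast_sum]
  refine Finset.sum_congr rfl fun i' _ => ?_
  rw [Finset.mul_sum, Int.cast_sum]
  refine Finset.sum_congr rfl fun j hj => ?_
  rw [Finset.mul_sum, Int.cast_sum]
  refine Finset.sum_congr rfl fun j' hj' => ?_
  have hj1 : j ≤ C i := Nat.lt_succ_iff.mp (Finset.mem_range.mp hj)
  have hj2 : j' ≤ C i' := Nat.lt_succ_iff.mp (Finset.mem_range.mp hj')
  have hle : n + ((B i + 2 * j + 1) + (B i' + 2 * j' + 1)) +
      2 * ((C i - j) + (C i' - j')) ≤ N := by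
    have := hN i i'; omega
  rw [sRow_getD Cmax n _ (by have := hC i i'; omega)]
  exact bridgeJ_term (A i) (A i') hle

/-- **From an exact-arithmetic certificate to Maynard's functional.** If the integer mirrors
satisfy `0 < N!·I` and `r · (N!·I) < (n+1) · (N!·J)`, then `F = P · 1_{R_{n+1}}` is an admissible
test function (`MaynardTao.isMaynardAdmissible_indicator`: continuous on `R_k`, cut off outside,
`I_k(F) > 0`) with `(∑ₘ J_k^{(m)}(F))/I_k(F) > r` (the sum over `m` is `k = n + 1` equal terms,
Lemma 7.2). This is Maynard's remark (§7, p. 16) that a rational approximation to the eigenvector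
lets one "verify this lower bound by calculating the ratio `∑ₘ J_k(F)/I_k(F)` using only exact
arithmetic". [cite: MaynardAnnals2015, §7, proof of Prop. 4.3 (i), (ii)] -/
theorem isMaynardAdmissible_and_lt_of_cert (n N Cmax : ℕ) (A : Fin d → ℤ) (B C : Fin d → ℕ)
    (hN : ∀ i i', n + (B i + B i') + 2 * (C i + C i') + 2 ≤ N) (hC : ∀ i i', C i + C i' ≤ Cmax)
    (r : ℕ) (hI : 0 < mirrorI (n + 1) N Cmax A B C)
    (hJ : (r : ℤ) * mirrorI (n + 1) N Cmax A B C < ((n + 1 : ℕ) : ℤ) * mirrorJ n N Cmax A B C) :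
    IsMaynardAdmissible (n + 1) (maynardF (n + 1) (fun i => (A i : ℝ)) B C) ∧
      (r : ℝ) < maynardFunctional (n + 1) (maynardF (n + 1) (fun i => (A i : ℝ)) B C) := by
  set F := maynardF (n + 1) (fun i => (A i : ℝ)) B C with hF
  have hIval : ((N.factorial : ℕ) : ℝ) * maynardI (n + 1) F = (mirrorI (n + 1) N Cmax A B C : ℝ) := by
    rw [hF, maynardI_maynardF]
    exact factorial_mul_maynardIValue (n + 1) N Cmax A B C (fun i i' => by have := hN i i'; omega) hC
  have hJval : ∀ m, ((N.factorial : ℕ) : ℝ) * maynardJ (n + 1) m F =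
      (mirrorJ n N Cmax A B C : ℝ) := fun m => by
    rw [hF, maynardJ_maynardF]
    exact factorial_mul_maynardJValue n N Cmax A B C hN hC
  have hNpos : (0 : ℝ) < (N.factorial : ℕ) := by exact_mod_cast N.factorial_pos
  have hIpos : 0 < maynardI (n + 1) F := by
    have h : (0 : ℝ) < ((N.factorial : ℕ) : ℝ) * maynardI (n + 1) F := by
      rw [hIval]; exact_mod_cast hI
    exact pos_of_mul_pos_right h hNpos.le
  have hadm : IsMaynardAdmissible (n + 1) F := by
    refine MaynardTao.isMaynardAdmissible_indicator (continuous_maynardPoly _ _ _ _) ?_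
    rw [← MaynardTao.maynardI_indicator_eq]
    exact hIpos
  refine ⟨hadm, ?_⟩
  rw [maynardFunctional, lt_div_iff₀ hIpos]
  refine lt_of_mul_lt_mul_left ?_ hNpos.le
  have hsum : ((N.factorial : ℕ) : ℝ) * ∑ m, maynardJ (n + 1) m F =
      ((n + 1 : ℕ) : ℝ) * (mirrorJ n N Cmax A B C : ℝ) := by
    rw [Finset.mul_sum]
    simp_rw [hJval]
    rw [Finset.sum_const, Finset.card_univ, Fintype.card_fin, nsmul_eq_mul]
  rw [hsum, mul_left_comm, hIval]
  exact_mod_cast hJ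

end Mirror

/-! ### The certificate for `M₁₀₅ > 4` (Prop. 4.3 (2)) -/

section Cert105

/-- Exponents `bᵢ` of `(1 − P₁)` in the `42` monomials `(1 − P₁)ᵇ P₂ᶜ`, `b + 2c ≤ 11`, ordered by
`c = 0, …, 5` and then `b = 0, …, 11 − 2c` (Maynard 2015 §7, proof of Prop. 4.3 (i): "a linear
combination of all monomials `(1 − P₁)ᵇ P₂ᶜ` with `b + 2c ≤ 11`. There are 42 such monomials").
[cite: MaynardAnnals2015, §7, proof of Prop. 4.3 (i)] -/
def certB : Fin 42 → ℕ :=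
  ![0, 1, 2, 3, 4, 5, 6, 7, 8, 9, 10, 11, 0, 1, 2, 3, 4, 5, 6, 7, 8, 9, 0, 1, 2, 3, 4, 5, 6, 7,
    0, 1, 2, 3, 4, 5, 0, 1, 2, 3, 0, 1]

/-- Exponents `cᵢ` of `P₂` in the `42` monomials (same order as `certB`).
[cite: MaynardAnnals2015, §7, proof of Prop. 4.3 (i)] -/
def certC : Fin 42 → ℕ :=
  ![0, 0, 0, 0, 0, 0, 0, 0, 0, 0, 0, 0, 1, 1, 1, 1, 1, 1, 1, 1, 1, 1, 2, 2, 2, 2, 2, 2, 2, 2,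
    3, 3, 3, 3, 3, 3, 4, 4, 4, 4, 5, 5]

/-- Integer coefficients `aᵢ` of the `42` monomials: a rational approximation (6 significant
digits, common denominator cleared) to the eigenvector of `M₁⁻¹M₂` for its largest eigenvalue
`λ = 4.0020697…` (Maynard 2015 §7, proof of Prop. 4.3 (i): "by taking a rational approximation
to the corresponding eigenvector, we can verify this lower bound … using only exact arithmetic";
the eigenvector was recomputed for this file, the resulting exact ratio being `4.00206…`).
[cite: MaynardAnnals2015, §7, proof of Prop. 4.3 (i)] -/
def certA : Fin 42 → ℤ :=
  ![68709, 36189850, 384189000, 2575210000, -1143910000000, 3030555000000, 150120000000000,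
    -402200500000000, -3093750000000000, -13758500000000000, 171397000000000000,
    -315800500000000000, -16513800, -8398750000, -116883000000, 1506700000000, 216529500000000,
    -1026015000000000, -20716950000000000, 51135500000000000, 661530000000000000,
    -2021775000000000000, 1619205000, 784095000000, 12298200000000, -318742500000000,
    -13975800000000000, 96620500000000000, 899260000000000000, -4618130000000000000,
    -81953000000, -37193300000000, -551760000000000, 20095300000000000, 317701500000000000,
    -3236085000000000000, 2164680000000, 908790000000000, 9158950000000000,
    -426414000000000000, -24010400000000, -9302450000000000]

/-- The degree bound `bᵢ + 2cᵢ ≤ 11` of the `42` monomials. [cite: MaynardAnnals2015, §7, proof of Prop. 4.3 (i)] -/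
theorem certB_add_two_mul_certC_le : ∀ i, certB i + 2 * certC i ≤ 11 := by decide

/-- `cᵢ ≤ 5` for the `42` monomials. [cite: MaynardAnnals2015, §7, proof of Prop. 4.3 (i)] -/
theorem certC_le : ∀ i, certC i ≤ 5 := by decide

set_option maxRecDepth 100000 in
/-- The exact-arithmetic certificate for `k = 105`, checked by the kernel:
`4 · (128!·I₁₀₅(F)) < 105 · (128!·J₁₀₅(F))` (ratio `4.00206… > 4`; Maynard reports the optimal
`λ ≈ 4.0020697`). [cite: MaynardAnnals2015, §7, proof of Prop. 4.3 (i)] -/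
theorem cert105_lt :
    (4 : ℤ) * mirrorI 105 128 10 certA certB certC < ((104 + 1 : ℕ) : ℤ) * mirrorJ 104 128 10 certA certB certC := by
  decide +kernel

set_option maxRecDepth 100000 in
/-- `128! · I₁₀₅(F) > 0` for the certificate polynomial (so `I₁₀₅(F) ≠ 0`, as required of
`F ∈ 𝒮_k`). [cite: MaynardAnnals2015, §7, proof of Prop. 4.3 (i)] -/
theorem cert105_pos : 0 < mirrorI 105 128 10 certA certB certC := by
  decide +kernel

/-- **Maynard 2015, Prop. 4.3 (2), with its witness**: the polynomial test function
`F = 1_{R₁₀₅} · ∑ᵢ certAᵢ (1 − P₁)^{certBᵢ} P₂^{certCᵢ}` is admissible and has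
`(∑ₘ J₁₀₅^{(m)}(F))/I₁₀₅(F) > 4`. [cite: MaynardAnnals2015, Prop. 4.3 (2) and §7, proof of Prop. 4.3 (i)] -/
theorem isMaynardAdmissible_and_four_lt_cert105 :
    IsMaynardAdmissible (104 + 1) (maynardF (104 + 1) (fun i => (certA i : ℝ)) certB certC) ∧
      ((4 : ℕ) : ℝ) < maynardFunctional (104 + 1) (maynardF (104 + 1) (fun i => (certA i : ℝ)) certB certC) :=
  isMaynardAdmissible_and_lt_of_cert 104 128 10 certA certB certC
    (fun i i' => by
      have := certB_add_two_mul_certC_le i; have := certB_add_two_mul_certC_le i'; omega)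
    (fun i i' => by have := certC_le i; have := certC_le i'; omega)
    4 cert105_pos (by exact_mod_cast cert105_lt)

end Cert105

/-! ### Consistency check: the certificate pipeline on Maynard's `k = 5` polynomial (Prop. 4.3 (1), `MaynardSmallK.lean`) -/

section Cert5

/-- Exponents of `(1 − P₁)` in Maynard's `P = (1 − P₁)P₂ + (7/10)(1 − P₁)² + (1/14)P₂ − (3/14)(1 − P₁)`
for `k = 5`, monomials in the printed order (Maynard 2015 §7, proof of Prop. 4.3 (ii), p. 16).
[cite: MaynardAnnals2015, §7, proof of Prop. 4.3 (ii)] -/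
def fiveB : Fin 4 → ℕ := ![1, 2, 0, 1]

/-- Exponents of `P₂` in Maynard's `P` for `k = 5` (printed order). [cite: MaynardAnnals2015, §7, proof of Prop. 4.3 (ii)] -/
def fiveC : Fin 4 → ℕ := ![1, 0, 1, 0]

/-- The coefficients `(1, 7/10, 1/14, −3/14)` of Maynard's `P` for `k = 5`, multiplied by `70`
(scaling `P` does not change the ratio): `(70, 49, 5, −15)`. [cite: MaynardAnnals2015, §7, proof of Prop. 4.3 (ii)] -/
def fiveA : Fin 4 → ℤ := ![70, 49, 5, -15]

set_option maxRecDepth 100000 in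
/-- The exact-arithmetic certificate for `k = 5`, checked by the kernel:
`2 · (16!·I₅(F)) < 5 · (16!·J₅(F))`; the exact ratio `5 J₅(F)/I₅(F)` is Maynard's printed
`1417255/708216 > 2`. [cite: MaynardAnnals2015, §7, proof of Prop. 4.3 (ii)] -/
theorem cert5_lt :
    (2 : ℤ) * mirrorI 5 16 2 fiveA fiveB fiveC < ((4 + 1 : ℕ) : ℤ) * mirrorJ 4 16 2 fiveA fiveB fiveC := by
  decide +kernel

set_option maxRecDepth 100000 in
/-- `16! · I₅(F) > 0` for Maynard's `P` (scaled by `70`). [cite: MaynardAnnals2015, §7, proof of Prop. 4.3 (ii)] -/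
theorem cert5_pos : 0 < mirrorI 5 16 2 fiveA fiveB fiveC := by
  decide +kernel

/-- **Consistency check with `MaynardSmallK.lean`** (where Prop. 4.3 (1) is discharged with the
exact value `maynardFunctional_maynardF5 = 1417255/708216`): the generic pipeline of this file
applied to Maynard's printed `k = 5` polynomial (scaled by `70`) confirms `F = 1_{R₅} · 70 P`
admissible with `(∑ₘ J₅^{(m)}(F))/I₅(F) > 2`. Not a second discharge of
`exists_two_lt_maynardFunctional_five` (see `Literature.NumberTheory.Sieve.exists_two_lt_maynardFunctional_five_holds` in
`MaynardSmallK.lean`). [cite: MaynardAnnals2015, Prop. 4.3 (1) and §7, proof of Prop. 4.3 (ii)] -/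
theorem isMaynardAdmissible_and_two_lt_cert5 :
    IsMaynardAdmissible (4 + 1) (maynardF (4 + 1) (fun i => (fiveA i : ℝ)) fiveB fiveC) ∧
      ((2 : ℕ) : ℝ) < maynardFunctional (4 + 1) (maynardF (4 + 1) (fun i => (fiveA i : ℝ)) fiveB fiveC) :=
  isMaynardAdmissible_and_lt_of_cert 4 16 2 fiveA fiveB fiveC
    (fun i i' => by fin_cases i <;> fin_cases i' <;> decide)
    (fun i i' => by fin_cases i <;> fin_cases i' <;> decide)
    2 cert5_pos (by exact_mod_cast cert5_lt)

end Cert5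

end Literature.NumberTheory.Sieve.MaynardK105

/-! ### The discharge -/

namespace Literature.NumberTheory.Sieve

open MaynardK105

/-- **Maynard 2015, Prop. 4.3 (2): `M₁₀₅ > 4`** — discharge of the named fact
`exists_four_lt_maynardFunctional` of `MaynardTao.lean`: there is an admissible `F` on `R₁₀₅`
with `(∑ₘ J₁₀₅^{(m)}(F))/I₁₀₅(F) > 4` (Maynard, Ann. of Math. 181 (2015), Prop. 4.3, proved in
§7 by the `42`-monomial polynomial and an exact-arithmetic check; here
`MaynardK105.isMaynardAdmissible_and_four_lt_cert105`). [cite: MaynardAnnals2015, Prop. 4.3 (2); §7, proof of Prop. 4.3 (i)] -/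
theorem exists_four_lt_maynardFunctional_holds : exists_four_lt_maynardFunctional := by
  obtain ⟨h1, h2⟩ := isMaynardAdmissible_and_four_lt_cert105
  exact ⟨_, h1, by exact_mod_cast h2⟩

end Literature.NumberTheory.Sieve
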